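import Summits.QuantumFields.BalabanUV.T4Continuum.Support.OutputRateTowerSocket

/-!
# OutputRateTowerSocketWitness — non-vacuity of `OutputRateTowerSocket` on the Data leaf's toy through a one-site tower,
# and the negative control (cell `pub-balaban`, T⁴-continuum fan-out, row NE5, owner lineage t4-ne5-p1, generation 26)

HONEST FRAMING as in `OutputRateTowerSocket`: rung (B)+1 finite T⁴; NE2's one-step covariant comparison (G-an2-4) and NE5
are NOT PRINTED and NOT PROVED; nothing of Bałaban's text is asserted; 0 cite tags; decided toys only.  NOT summit progress.

* A ONE-SITE TOWER FAMILY (`unitTowerA j k = 1`, `unitTowerX j k = 2(1/2)^k · 1` on `Matrix Unit Unit ℂ`, `r = 1`): contracting,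
  obeys row NE2's law `OneStepAveragedLaw` with `Cop = 1`, `θ = 1/2` (`unitTower_law`; a one-line computation here — at U = 1
  row NE2's leaves prove the law for King's and Bałaban's averagings, at U ≠ 1 it is G-an2-4), consecutive unit-lattice
  images differ by exactly `(1/2)^k` in norm (`norm_unitTower_increment`).
* The Data leaf's `toyModel` READS it with reading constant `1` (`toy_readsTower`); the socket's §1 returns the liaison's
  `toy_absRate` rate (`toy_absRate_of_towerLaw`); the socket's §2 slower-rate face fires END-TO-END with W1 supplied by the
  tower law and every other binder the Data leaf's toy lemmas — constant `31/30`, the residual's (`toy_ne5_of_towerLaw`).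
* NEGATIVE CONTROL (liaison (L2) at this socket): the liaison's two-entry `finestToyModel` — one entry with the persistent
  lattice-scale artefact `1/10` — reads NO contracting tower family obeying the law at a rate `θ < 1`, whatever the index
  set, towers, constants and reading map (`finestToy_not_readsTower`): species with persistent lattice-scale entries are not
  tower-readable; they belong to the spine's weight channel (node U5c), not to a rate binder.

WHAT IS PROVED: decided computations on a 1 × 1 tower and compositions BY NAME.  0 sorry; axioms standard; imports
`Support/OutputRateTowerSocket` only and modifies nothing.
-/

noncomputable section

open Set Metric
open scoped Matrix Matrix.Norms.L2Operator

namespace Summit.QuantumFields.BalabanUV.T4Continuum.OutputRateTowerSocketWitness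

open Literature.MathematicalPhysics.QuantumFieldTheory.Balaban1983to89
open Literature.MathematicalPhysics.QuantumFieldTheory.Balaban1983to89.T4OutputRate
open Literature.MathematicalPhysics.QuantumFieldTheory.Balaban1983to89.T4InputCauchyRate
open Literature.MathematicalPhysics.QuantumFieldTheory.Balaban1983to89.T4InputCauchyRateData
open Literature.MathematicalPhysics.QuantumFieldTheory.Balaban1983to89.T4OperatorRateLiaison
open Summit.QuantumFields.BalabanUV.T4Continuum.CovariantAveragingTower
open Summit.QuantumFields.BalabanUV.T4Continuum.OutputRateTowerSocket

/-! ## §1 The one-site tower family and its law -/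

section Toy

/-- The one-site tower family's averagings: the identity on `Unit` at every level (index set `Unit`). [folklore] -/
def unitTowerA : (j : Unit) → (k : ℕ) → Matrix Unit Unit ℂ := fun _ _ => 1

/-- The one-site tower family's level objects: `X k = 2(1/2)^k · 1`, so that consecutive unit-lattice images differ by
exactly `(1/2)^k · 1`. [folklore] -/
def unitTowerX : (j : Unit) → (k : ℕ) → Matrix Unit Unit ℂ := fun _ k => (((2 * (1 / 2) ^ k : ℝ) : ℂ)) • 1

/-- The composite averaging of the one-site tower is the identity at every level. [folklore] -/
theorem Atow_unitTowerA (j : Unit) (k : ℕ) : Atow (unitTowerA j) k = 1 := by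
  induction k with
  | zero => rfl
  | succ k ih => rw [Atow_succ, ih]; simp [unitTowerA]

/-- The unit-lattice image of the one-site tower at level `k` is `X k` itself (`r = 1`). [folklore] -/
theorem avgTow_unitTower (j : Unit) (k : ℕ) : avgTow (unitTowerA j) 1 (unitTowerX j) k = unitTowerX j k := by
  simp [avgTow, Atow_unitTowerA]

/-- The consecutive increment of the one-site tower is `−(1/2)^k · 1`. [folklore] -/
theorem unitTower_increment (j : Unit) (k : ℕ) :
    avgTow (unitTowerA j) 1 (unitTowerX j) (k + 1) - avgTow (unitTowerA j) 1 (unitTowerX j) k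
      = (((-(1 / 2 : ℝ) ^ k : ℝ)) : ℂ) • (1 : Matrix Unit Unit ℂ) := by
  rw [avgTow_unitTower, avgTow_unitTower, unitTowerX, unitTowerX, ← sub_smul, ← Complex.ofReal_sub]
  congr 2
  ring

/-- The norm of that increment is exactly `(1/2)^k`. [folklore] -/
theorem norm_unitTower_increment (j : Unit) (k : ℕ) :
    ‖avgTow (unitTowerA j) 1 (unitTowerX j) (k + 1) - avgTow (unitTowerA j) 1 (unitTowerX j) k‖ = (1 / 2 : ℝ) ^ k := by
  rw [unitTower_increment, norm_smul, norm_one, mul_one, Complex.norm_real, norm_neg, norm_pow]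
  norm_num

/-- The one-site family is contracting with `r = 1`. [folklore] -/
theorem unitTower_contracting : TowerContracting unitTowerA 1 := by
  intro j k
  rw [inv_one, unitTowerA]
  calc ‖(1 : Matrix Unit Unit ℂ)‖ ^ 2 ≤ (1 : ℝ) ^ 2 := pow_le_pow_left₀ (norm_nonneg _) (opNorm_one_le (ι := fun _ => Unit) 0) 2
    _ = 1 := one_pow 2

/-- The one-site family obeys row NE2's law with `Cop = 1`, `θ = 1/2` (here a one-line computation — at U = 1 row NE2's
leaves prove the law for King's and Bałaban's averagings; at U ≠ 1 it is G-an2-4). [folklore] -/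
theorem unitTower_law : TowerLaw unitTowerA unitTowerX 1 1 (1 / 2) := by
  intro j k
  have h : unitTowerA j k * unitTowerX j (k + 1) * (unitTowerA j k)ᴴ - ((1 : ℝ) : ℂ)⁻¹ • unitTowerX j k
      = avgTow (unitTowerA j) 1 (unitTowerX j) (k + 1) - avgTow (unitTowerA j) 1 (unitTowerX j) k := by
    rw [avgTow_unitTower, avgTow_unitTower]
    simp [unitTowerA]
  rw [h, norm_unitTower_increment]
  norm_num

/-- **The Data leaf's `toyModel` READS the one-site family** with reading constant `1` (every step reads the one tower):
`‖(1/2)^k − 0‖ ≤ 1 · (1/2)^k`. [folklore] -/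
theorem toy_readsTower : ReadsTower toyModel unitTowerA unitTowerX 1 Set.univ 1 (fun _ _ _ => ()) := by
  intro k g _ U
  rw [norm_unitTower_increment, one_mul]
  show ‖(((1 / 2 : ℝ) ^ k : ℝ) : ℂ) - 0‖ ≤ (1 / 2) ^ k
  rw [sub_zero, Complex.norm_real, Real.norm_eq_abs, abs_of_nonneg (by positivity)]

/-- §1 on the toy returns the liaison's `toy_absRate` (rate `(1/2)^k`, constant `1·1`). [folklore] -/
theorem toy_absRate_of_towerLaw : AbsOperatorRate toyModel Set.univ (1 * 1) (1 / 2) :=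
  absRate_of_towerLaw toyModel one_pos unitTower_contracting unitTower_law toy_readsTower zero_le_one

/-- **END-TO-END NON-VACUITY OF THE SOCKET**: §2's slower-rate face fires on the toy with W1 supplied by the one-site tower
law (`Cop = 1`, `cR = 1`, floor `r₀ = 1`), the Data leaf's toy binders for everything else (`Λ = 1`, reach `ρ₀ = 2`,
`c = ω = 1/64`, `δ′ = 0`, `k₀ = 0`, `B = 0`, `θ = θ′ = 1/2`); the constant is the residual's `31/30`. [folklore] -/
theorem toy_ne5_of_towerLaw : NE5 toyEA₂ toyEB (Set.univ : Set (ℕ → ℝ)) 0 (1 / 2)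
    ((1 * (1 * 1 / 1 + 0) + 0) * (1 / 2 - 1 / 64) / (1 / 2 - (1 / 64 + 1 * (1 / 64)))) :=
  ne5_at_of_towerLaw_lip_nat toyModel (ρ₀ := 2) (B := 0) (k₀ := 0) one_pos unitTower_contracting unitTower_law
    toy_readsTower zero_le_one zero_le_one (r₀ := 1) (fun k => by simpa using toy_marginFloor k) one_pos toy_representsA
    toy_representsB toy_inBase (toy_dataLipschitz 2) toy_decayA toy_decayB toy_insertionRate toy_insertionDampedNat
    (by norm_num) le_rfl (by norm_num) le_rfl (by norm_num) (by norm_num) (by norm_num) (by norm_num) le_rfl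
    (fun k hk => absurd hk (Nat.not_lt_zero k)) (by norm_num)

/-- The toy constant in lowest terms (= the residual's `31/30`). [folklore] -/
example : ((1 * (1 * 1 / 1 + 0) + 0) * (1 / 2 - 1 / 64) / (1 / 2 - (1 / 64 + 1 * (1 / 64))) : ℝ) = 31 / 30 := by
  norm_num

/-- **NEGATIVE CONTROL** (liaison (L2) at this socket): the liaison's two-entry `finestToyModel` — one entry with the
persistent lattice-scale artefact `1/10` — reads NO contracting tower family obeying row NE2's law at a rate `θ < 1`,
whatever the index set, the towers, the constants `Cop ≥ 0`, `cR ≥ 0` and the reading map: such a reading would give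
`AbsOperatorRate` at rate `θ < 1` (§1), which `finestToy_not_absRate` forbids. [folklore] -/
theorem finestToy_not_readsTower {J : Type*} {ι : J → ℕ → Type*} [∀ j k, Fintype (ι j k)] [∀ j k, DecidableEq (ι j k)]
    {A : (j : J) → (k : ℕ) → Matrix (ι j k) (ι j (k + 1)) ℂ} {X : (j : J) → (k : ℕ) → Matrix (ι j k) (ι j k) ℂ}
    {r Cop θ cR : ℝ} {tow : ℕ → (ℕ → ℝ) → toyCarriers.BgB → J} (hr : 0 < r) (hA : TowerContracting A r)
    (hlaw : TowerLaw A X r Cop θ) (hcR : 0 ≤ cR) (hθ0 : 0 ≤ θ) (hθ1 : θ < 1) :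
    ¬ ReadsTower finestToyModel A X r Set.univ cR tow := fun hread =>
  finestToy_not_absRate hθ0 hθ1 (absRate_of_towerLaw finestToyModel hr hA hlaw hread hcR)

end Toy

end Summit.QuantumFields.BalabanUV.T4Continuum.OutputRateTowerSocketWitness

end
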